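import Summits.Langlands.Langlands.Statement
import Literature.NumberTheory.DiophantineGeometry.BcgpResiduallyA5bModular
import Literature.NumberTheory.DiophantineGeometry.AbelianVarietyOrdinaryReduction
import Literature.NumberTheory.Automorphic.IsAutomorphicAE
import HarnessLib

/-!
# F3 `_special` — the floor is LITERALLY the family at `f = 2` (line `A5bTwoRankOne`, crux
`ReciprocityUpToIrreducibility`, item stmt-Langlands-14328; G4 ladder-down generation 24)

`floor_two : bcgp_residuallyA5b_modular_abelianSurface → A5bStratumModular 2`: the in-tree named fact (Boxer–Calegari–
Gee–Pilloni 2025, Thm. 8.3.2, arXiv:2502.20645 p. 124: `2`-adic ORDINARY modularity of residually-`A₅(b)` abelian surfaces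
over `ℚ`, `GL₄` a.e.-Satake form) IS the member `f = 2` of the Newton-stratum family: the stratum `f = 2` is, by
definition, hypothesis (3) of Thm. 8.3.2 in BCGP's own Galois form (semistable-or-good reduction at `2` with every framed
dual of `V₂(B)` ordinary and `2`-distinguished), the frame hypotheses (1)–(2) are verbatim, and the family's conclusion
`IsModularGL4` is the fact's conclusion read through `SatakeFrobCompatibleAE` after discarding three TRUE extra
hypotheses (irreducible, unramified a.e., de Rham for Fontaine's pinned datum).  Witness regime: the residually-`A₅(b)`,
ordinary-at-`2` abelian surfaces over `ℚ` — modularity of abelian surfaces over `ℚ` (the paramodular conjecture) is known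
in NO Newton stratum in general; the floor is the 2025 theorem, the rung `f = 1` the first non-ordinary stratum.
Also recorded: `hasGoodReductionOfPRankAt_dim_iff` (the top `p`-rank stratum is `HasGoodOrdinaryReductionAt`, `Iff.rfl`)
and `family_vacuous` (no stratum `f ≥ 3`).  No `sorry`.
-/

noncomputable section

set_option linter.dupNamespace false

open scoped MatrixGroups Matrix NumberField Classical
open Filter IsDedekindDomain IsDedekindDomain.HeightOneSpectrum CategoryTheory
open Literature.NumberTheory.Automorphic Literature.NumberTheory.GaloisRepresentations
open Literature.NumberTheory.PAdicHodge Literature.NumberTheory.DiophantineGeometry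
open Literature.AlgebraicGeometry.Motives (AbelianVariety SchemeOver)
open Summit.Langlands

namespace Summit.Langlands.Langlands.Cruxes.ReciprocityUpToIrreducibility.A5bTwoRankOne

/-! ## 1. The hypotheses of BCGP Thm. 8.3.2, the Newton strata at `2`, the modularity conclusion -/

/-- **Hypotheses (1)–(2) of BCGP 2025 Thm. 8.3.2** (verbatim from the in-tree fact): in some additive frame of
`B[2](ℚ̄)` the Galois action is through `S₅(b)` (`s5bMatrix`), every even permutation is realised (`A₅(b) ⊆ image`),
and every complex conjugation acts by a double transposition (order `2`, inside `A₅(b)`). -/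
def IsResiduallyA5b (B : AbelianVariety ℚ) : Prop :=
  ∃ e : B.geomTorsion (2 : ℕ) ≃+ (Fin 4 → ZMod 2),
    (∀ g : Field.absoluteGaloisGroup ℚ, ∃ σ : Equiv.Perm (Fin 5),
        ∀ P : B.geomTorsion (2 : ℕ), e (g • P) = s5bMatrix σ *ᵥ e P) ∧
    (∀ σ : Equiv.Perm (Fin 5), Equiv.Perm.sign σ = 1 →
        ∃ g : Field.absoluteGaloisGroup ℚ,
          ∀ P : B.geomTorsion (2 : ℕ), e (g • P) = s5bMatrix σ *ᵥ e P) ∧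
    (∀ c : Field.absoluteGaloisGroup ℚ, IsComplexConjugation (algebraMap ℚ ℝ) c →
        ∃ σ : Equiv.Perm (Fin 5), σ.cycleType = {2, 2} ∧
          ∀ P : B.geomTorsion (2 : ℕ), e (c • P) = s5bMatrix σ *ᵥ e P)

/-- **Hypothesis (3) of BCGP 2025 Thm. 8.3.2 = the ORDINARY stratum at `2` in Galois form** (verbatim from the
in-tree fact): semistable-or-good reduction at `2` (`(ρ_ℓ(τ) − 1)² = 0` for inertia `τ` at `2`, `ℓ ≠ 2`, SGA 7 IX 3.5)
and every framed dual `r₂` of `V₂(B)` ordinary and `2`-distinguished at `v ∣ 2` (Def. 1.8.8).  It CONTAINS the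
geometric stratum "good ordinary (`2`-rank `2`), `2`-distinguished reduction" (Serre–Tate / Greenberg: the named fact
`ordinaryReduction_tateModule_filtration`). -/
def IsOrdinaryStratumAtTwo (B : AbelianVariety ℚ) : Prop :=
  (∀ (ℓ : ℕ) [Fact ℓ.Prime], ℓ ≠ 2 →
    ∀ v : HeightOneSpectrum (𝓞 ℚ), ((2 : ℕ) : 𝓞 ℚ) ∈ v.asIdeal →
      ∀ τ ∈ absInertia (v.adicCompletion ℚ),
        (B.rationalTateRep ℓ (absGaloisRestrict ℚ (v.adicCompletion ℚ) τ) - 1) ^ 2 = 0) ∧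
  (∀ (b₂ : Module.Basis (Fin 4) ℚ_[2] (B.rationalTateModule 2))
      (r₂ : FramedGaloisRep ℚ (PadicAlgCl 2) 4),
      (∀ g : Field.absoluteGaloisGroup ℚ,
        (r₂ g).val =
          ((LinearMap.toMatrix b₂ b₂ (B.rationalTateRep 2 g⁻¹)).map
            (algebraMap ℚ_[2] (PadicAlgCl 2))).transpose) →
      ∀ v : HeightOneSpectrum (𝓞 ℚ), ((2 : ℕ) : 𝓞 ℚ) ∈ v.asIdeal →
        r₂.IsOrdinaryPDistinguishedAt v)

/-- **Good reduction at `v` of `p`-rank `f`**: an abelian-scheme model `𝒜` of `A` over `𝓞_{K,v}` (Serre–Tate §1,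
`IsAbelianSchemeModel`) whose special fibre has exactly `p ^ f` geometric points of order dividing `p = char κ(v)`
(`specialFibrePTorsionCard`; Li–Oort §0.6: the `p`-rank).  At `f = dim A` this is LITERALLY the tree's
`AbelianVariety.HasGoodOrdinaryReductionAt` (`hasGoodReductionOfPRankAt_dim_iff`, `Iff.rfl`). -/
def HasGoodReductionOfPRankAt {K : Type} [Field K] [NumberField K] (A : AbelianVariety K)
    (v : HeightOneSpectrum (𝓞 K)) (f : ℕ) : Prop :=
  ∃ (𝒜 : SchemeOver (valuationSubringAtPrime K v)) (_ : GrpObj 𝒜),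
    IsAbelianSchemeModel A v 𝒜 ∧ specialFibrePTorsionCard v 𝒜 = residueChar v ^ f

/-- The top stratum `f = dim A` of the `p`-rank is good ORDINARY reduction (definitionally). [folklore] -/
theorem hasGoodReductionOfPRankAt_dim_iff {K : Type} [Field K] [NumberField K] (A : AbelianVariety K)
    (v : HeightOneSpectrum (𝓞 K)) : HasGoodReductionOfPRankAt A v A.dim ↔ A.HasGoodOrdinaryReductionAt v :=
  Iff.rfl

/-- **The Newton strata at `2`, indexed by the `2`-rank `f`** (THE DIAL): `f = 2` the ordinary stratum in BCGP's
Galois form (what the printed floor assumes), `f = 1` good reduction at `2` of `2`-rank one (Newton slopes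
`0, ½, ½, 1`: "Klingen-ordinary, Siegel-slope ½"), `f = 0` good supersingular reduction at `2` (all slopes `½`);
no stratum for `f ≥ 3` (a surface has `2`-rank `≤ 2`). -/
def NewtonStratumAtTwo : ℕ → AbelianVariety ℚ → Prop
  | 0, B => ∀ v : HeightOneSpectrum (𝓞 ℚ), ((2 : ℕ) : 𝓞 ℚ) ∈ v.asIdeal → HasGoodReductionOfPRankAt B v 0
  | 1, B => ∀ v : HeightOneSpectrum (𝓞 ℚ), ((2 : ℕ) : 𝓞 ℚ) ∈ v.asIdeal → HasGoodReductionOfPRankAt B v 1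
  | 2, B => IsOrdinaryStratumAtTwo B
  | _, _ => False

/-- **"`B` is modular" in the summit's `GL₄` a.e.-Satake form** (the conclusion of BCGP Thm. 8.3.2 as vendored,
weakened by three TRUE extra hypotheses on the framed dual `r` of `V_p(B)` — irreducible (Faltings + `A₅(b)`),
unramified a.e. (Néron–Ogg–Shafarevich), de Rham above `p` for Fontaine's pinned datum (Fontaine–Faltings) — so that
clause (B) of E applies to `r` literally): for every prime `p`, every framed dual `r` of `V_p(B)` and every
`ι : ℚ̄_p ≃ ℂ` there is an automorphic representation of `GL₄(𝔸_ℚ)` whose Satake parameters give `det(X − r(Frob_v))`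
at almost every `v` (`SatakeFrobCompatibleAE`). -/
def IsModularGL4 (B : AbelianVariety ℚ) : Prop :=
  ∀ (p : ℕ) [Fact p.Prime] (b : Module.Basis (Fin 4) ℚ_[p] (B.rationalTateModule p))
    (r : FramedGaloisRep ℚ (PadicAlgCl p) 4),
    (∀ g : Field.absoluteGaloisGroup ℚ,
      (r g).val =
        ((LinearMap.toMatrix b b (B.rationalTateRep p g⁻¹)).map
          (algebraMap ℚ_[p] (PadicAlgCl p))).transpose) →
    r.toGaloisRep.IsIrreducible →
    (∀ᶠ v : HeightOneSpectrum (𝓞 ℚ) in cofinite, r.IsUnramifiedAt v) →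
    (∀ (w : HeightOneSpectrum (𝓞 ℚ)) (hw : ((p : ℕ) : 𝓞 ℚ) ∈ w.asIdeal),
        (fontainePstAdicCompletion w p hw).IsDeRhamFramed (r.toLocal w)) →
    ∀ (hcpt : isCompact_glFiniteIntegralLevel 4 ℚ) (ι : PadicAlgCl p ≃+* ℂ),
      ∃ π : AutomorphicRepData (AutomorphyDatum.gl 4 ℚ hcpt), SatakeFrobCompatibleAE ι π r

/-- **The RUNG FAMILY, dial = the `2`-rank `f`**: every residually-`A₅(b)` abelian surface `B/ℚ` in the Newton
stratum `f` at `2` is modular. -/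
def A5bStratumModular (f : ℕ) : Prop :=
  ∀ B : AbelianVariety ℚ, B.dim = 2 → IsResiduallyA5b B → NewtonStratumAtTwo f B → IsModularGL4 B

/-- **THE RUNG (θ26 = 1)**: residually-`A₅(b)` abelian surfaces over `ℚ` with good reduction at `2` of `2`-RANK ONE
(non-ordinary, Newton slopes `0, ½, ½, 1`) are modular. -/
def A5bTwoRankOne : Prop := A5bStratumModular 1

/-- **The higher rung (θ26 = 0)**: residually-`A₅(b)` abelian surfaces over `ℚ` with good SUPERSINGULAR reduction
at `2` are modular. -/
def A5bSupersingular : Prop := A5bStratumModular 0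

/-! ## F3: the floor fact gives the family at the floor value `f = 2` (no sorry) -/

/-- **F3: the family at `f = 2` IS THE FLOOR** — BCGP 2025 Thm. 8.3.2 (in-tree named fact). -/
theorem floor_two (h : bcgp_residuallyA5b_modular_abelianSurface) : A5bStratumModular 2 := by
  intro B hdim hres hstr p _ b r hfr _hirr _hunr _hdR hcpt ι
  obtain ⟨π, -, hπ⟩ := h B hdim hres hstr.1 hstr.2 p b r hfr hcpt ι
  exact ⟨π.1, hπ⟩

/-- No stratum above the dimension: the members `f ≥ 3` are vacuous. -/
theorem family_vacuous (f : ℕ) (hf : 3 ≤ f) : A5bStratumModular f := by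
  obtain ⟨k, rfl⟩ : ∃ k, f = k + 3 := ⟨f - 3, by omega⟩
  intro B _ _ hstr
  exact (hstr : False).elim

/-- F3 in the filter's literal shape. -/
example (h : bcgp_residuallyA5b_modular_abelianSurface) : A5bStratumModular 2 := by simpa using floor_two h

end Summit.Langlands.Langlands.Cruxes.ReciprocityUpToIrreducibility.A5bTwoRankOne

end
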